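import Literature.AlgebraicGeometry.Motives.AbelianVarietyGoodReductionReductionMap
import Literature.AlgebraicGeometry.Motives.AbelianSchemeModelConjFrobTateCompatibleOfPoints
import Literature.AlgebraicGeometry.Motives.AbelianSchemeModelTwistedReductionTate
import Literature.AlgebraicGeometry.Motives.AbelianVarietyConjugateTransport
import HarnessLib

/-!
# Tate compatibility of the companions of a Frobenius conjugate, FROM the twisted-reduction identity on points
# — [Shimura 1998, §18.6 proof of Thm. 18.6, p. 129 «`(Y^σ)~ = Ỹ^f` … `(t^σ)~ = π(t̃)`»; §11.1 Prop. 14 (i)]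

Topic `Literature/AlgebraicGeometry/Motives`; namespace `Literature.NumberTheory.DiophantineGeometry.IsAbelianSchemeModel`.
THEOREMS ONLY (no definition, no named fact; net Literature debt 0).  Cell `hodgecm-mathlib` (D-0151), row II-1, edition
E4 «S5c′ ↦ Q5», piece **(B)** of the Q5 road of record (B-p09 allocation 2026-08-28T09:27:08Z; director BATCH 109 (3)).

WHAT IS HERE.  Fix abelian-scheme models `𝒜ᵢ`, `𝒜ₐ` of `Aᵢ`, `Aₐ` at `v`, an arithmetic Frobenius `γ ∈ Aut(K/F₀)` at `v`
with `q = pⁿ`, and `σ̃ ∈ Aut(K̄)` over `γ`.  The hypothesis `hQ5` of the cell's closing theorem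
`Hyp21.…_isTateCompatible_of_twistedReduction` (★ p620235) — Tate compatibility, along the transported datum
`(ha.tateSpecialisation ℓ hℓv).conjFrob …` (★ p619784), of EVERY companion datum `Hγ : HomReduction (𝒜ᵢ-datum)
((𝒜ₐ-datum)^γ)` and `Hγ' : HomReduction ((𝒜ₐ-datum)^γ) (𝒜ᵢ-datum)` — was reduced by ★ p620831
(`isTateCompatible_conjFrob_of_forall_geomPointsMap` / `…conjFrob'…`) to two POINT identities involving the unknown
reductions `Hγ.redHom f`, `Hγ'.redHom g`.  By the naturality of the reduction map of an ARBITRARY good-reduction datum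
under ANY `HomReduction` (`GoodReductionAt.HomReduction.geomReductionMap_geomPointsMap`, file
`AbelianVarietyGoodReductionReductionMap`) both identities — for every `Hγ`, `Hγ'` at once — follow from the ONE
`σ̃`-side identity on the EXPLICIT conjugate datum `ha.goodReductionAt.conjFrob γ hγ p n hq`:

  **(TW)** `red_{(𝒜ₐ-datum)^γ} (y^σ̃) = π (red_v y)` for every geometric point `y ∈ Aₐ(K̄)`,

i.e. `(ha.goodReductionAt.conjFrob γ hγ p n hq).geomReductionMap (conjTransport γ.toRingEquiv σt hσa Aₐ y) =
Hom.geomPointsMap (ha.specialFibre.relFrobenius p n) (ha.specialFibreReductionHom y)` — the reduction map of the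
`γᵥ`-twisted model `𝒜ₐ ⊗_{γᵥ} 𝓞ᵥ` on `σ̃`-conjugate points is the relative Frobenius `π : Ã → Ã^{(q)}` of the reduction
map of `𝒜ₐ` ([Shimura1998] p. 129 «`(Y^σ)~ = Ỹ^f` … `(t^σ)~ = π(t̃)`»).

* `isTateCompatible_conjFrob_of_twistedReductionMap`, `isTateCompatible_conjFrob'_of_twistedReductionMap` — the two
  directions for fixed data, from (TW) for the given `σ̃`;
* `forall_isTateCompatible_conjFrob_of_twistedReductionMap` — the hypothesis `hQ5` of ★ p620235 VERBATIM, from (TW)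
  stated once for all data with `σ̃` a Frobenius at `adicCompletionPrime K v` (`hσ𝔓`, ℓ-free); and
  `forall_isTateCompatible_homReduction_conjFrob_tateSpecialisation_of_twistedReductionMap` — the same with the tree's
  NAME of Q5 (`IsAbelianSchemeModel.forall_isTateCompatible_homReduction_conjFrob_tateSpecialisation`, ★ p621613) as the
  conclusion.

HC_CM is proved only modulo the 7 printed citations until rung 0 closes.

## References
* [Shimura1998] G. Shimura, *Abelian Varieties with Complex Multiplication and Modular Functions*, Princeton 1998,
  §11.1 Prop. 14 (i); §18.6 proof of Thm. 18.6, p. 129.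
* [SerreTate1968] J.-P. Serre, J. Tate, *Good reduction of abelian varieties*, Ann. of Math. 88 (1968), §1.
-/

set_option autoImplicit false

noncomputable section

open CategoryTheory AlgebraicGeometry IsDedekindDomain IsDedekindDomain.HeightOneSpectrum
open scoped NumberField
open Literature.NumberTheory.EllipticCurves Literature.NumberTheory.GaloisRepresentations
open Literature.AlgebraicGeometry.Motives Literature.AlgebraicGeometry.Motives.AbelianVariety

namespace Literature.NumberTheory.DiophantineGeometry

namespace IsAbelianSchemeModel

section Fixed

variable {F₀ K : Type} [Field F₀] [Field K] [NumberField K] [Algebra F₀ K] {v : HeightOneSpectrum (𝓞 K)}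
  {Aᵢ Aₐ : AbelianVariety K} {𝒜ᵢ 𝒜ₐ : SchemeOver (valuationSubringAtPrime K v)} [GrpObj 𝒜ᵢ] [GrpObj 𝒜ₐ]
  (hi : IsAbelianSchemeModel Aᵢ v 𝒜ᵢ) (ha : IsAbelianSchemeModel Aₐ v 𝒜ₐ) (γ : K ≃ₐ[F₀] K)
  (hγ : IsArithFrobAt (𝓞 F₀) γ v.asIdeal) (p n : ℕ) [ExpChar v.asIdeal.ResidueField p]
  (hq : Nat.card (𝓞 F₀ ⧸ v.asIdeal.under (𝓞 F₀)) = p ^ n)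
  (σt : AlgebraicClosure K ≃+* AlgebraicClosure K)
  (hσa : ∀ a : K, σt (algebraMap K (AlgebraicClosure K) a) = algebraMap K (AlgebraicClosure K) (γ.toRingEquiv a))
  (ℓ : ℕ) [Fact ℓ.Prime] (hℓv : ((ℓ : ℕ) : 𝓞 K) ∉ v.asIdeal)
  (hσ𝔓 : ∀ x : absIntegers (𝓞 K) K, ∃ hx : σt x ∈ absIntegers (𝓞 K) K,
    (⟨σt x, hx⟩ : absIntegers (𝓞 K) K) - x ^ Nat.card (𝓞 F₀ ⧸ v.asIdeal.under (𝓞 F₀)) ∈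
      (ha.tateSpecialisation ℓ hℓv).prime)

/-- **Q5 ⇐ (TW).**  For ANY companion datum `Hγ : HomReduction (𝒜ᵢ-datum) ((𝒜ₐ-datum)^γ)`, Tate compatibility with
the produced datum of `𝒜ᵢ` and the transported datum of the conjugate follows from the twisted-reduction identity (TW)
`red_{(𝒜ₐ-datum)^γ} (y^σ̃) = π (red_v y)` on `Aₐ(K̄)`: the unknown reduction `Hγ.redHom f` is absorbed by the naturality of
the reduction map of the conjugate datum (`geomReductionMap_geomPointsMap_of_homReduction`), and ★ p620831 does the
`T_ℓ` bookkeeping. [cite: Shimura1998, §18.6 proof of Thm. 18.6, p. 129; §11.1 Prop. 14 (i)] -/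
theorem isTateCompatible_conjFrob_of_twistedReductionMap
    (Hγ : GoodReductionAt.HomReduction hi.goodReductionAt (ha.goodReductionAt.conjFrob γ hγ p n hq))
    (hTW : ∀ y : Aₐ.geomPoints,
      (ha.goodReductionAt.conjFrob γ hγ p n hq).geomReductionMap (conjTransport γ.toRingEquiv σt hσa Aₐ y) =
        Hom.geomPointsMap (ha.specialFibre.relFrobenius p n) (ha.specialFibreReductionHom y)) :
    Hγ.IsTateCompatible (hi.tateSpecialisation ℓ hℓv)
      ((ha.tateSpecialisation ℓ hℓv).conjFrob γ hγ p n hq σt hσa hσ𝔓) := by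
  refine isTateCompatible_conjFrob_of_forall_geomPointsMap hi ha γ hγ p n hq σt hσa ℓ hℓv hσ𝔓 Hγ fun f x => ?_
  rw [← hi.geomReductionMap_geomPointsMap_of_homReduction Hγ f x,
    ← (conjTransport γ.toRingEquiv σt hσa Aₐ).apply_symm_apply (Hom.geomPointsMap f x), hTW,
    AddEquiv.symm_apply_apply]

/-- **Q5′ ⇐ (TW).**  For ANY reverse companion datum `Hγ' : HomReduction ((𝒜ₐ-datum)^γ) (𝒜ᵢ-datum)`, Tate compatibility
follows from the same identity (TW): the unknown `Hγ'.redHom g` is absorbed by the naturality of the reduction map INTO the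
produced datum (`specialFibreReductionHom_geomPointsMap_of_homReduction`). [cite: Shimura1998, §18.6 proof of Thm. 18.6, p. 129; §11.1 Prop. 14 (i)] -/
theorem isTateCompatible_conjFrob'_of_twistedReductionMap
    (Hγ' : GoodReductionAt.HomReduction (ha.goodReductionAt.conjFrob γ hγ p n hq) hi.goodReductionAt)
    (hTW : ∀ y : Aₐ.geomPoints,
      (ha.goodReductionAt.conjFrob γ hγ p n hq).geomReductionMap (conjTransport γ.toRingEquiv σt hσa Aₐ y) =
        Hom.geomPointsMap (ha.specialFibre.relFrobenius p n) (ha.specialFibreReductionHom y)) :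
    Hγ'.IsTateCompatible ((ha.tateSpecialisation ℓ hℓv).conjFrob γ hγ p n hq σt hσa hσ𝔓)
      (hi.tateSpecialisation ℓ hℓv) := by
  refine isTateCompatible_conjFrob'_of_forall_geomPointsMap hi ha γ hγ p n hq σt hσa ℓ hℓv hσ𝔓 Hγ' fun g y => ?_
  rw [hi.specialFibreReductionHom_geomPointsMap_of_homReduction Hγ' g, hTW]

end Fixed

/-- **The hypothesis `hQ5` of the cell's closing theorem ★ p620235 (`S5c′` from Q5), VERBATIM, from the twisted-reduction
identity (TW) stated once for all data** — for every abelian-scheme model `𝒜ₐ` of `Aₐ` at `v`, every arithmetic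
Frobenius `γ` at `v` over `F₀` with `q = pⁿ`, and every `σ̃ ∈ Aut(K̄)` over `γ` which is a Frobenius at the produced
prime `adicCompletionPrime K v` (`σ̃ x ≡ x^q`; the `ℓ`-free form of `hσ𝔓`, `tateSpecialisation_prime`):
`red_{(𝒜ₐ-datum)^γ} (y^σ̃) = π (red_v y)` on `Aₐ(K̄)` ([Shimura1998] p. 129 «`(Y^σ)~ = Ỹ^f` … `(t^σ)~ = π(t̃)`»).
[cite: Shimura1998, §18.6 proof of Thm. 18.6, p. 129; §11.1 Prop. 14 (i)] -/
theorem forall_isTateCompatible_conjFrob_of_twistedReductionMap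
    (hTW : ∀ {F₀ K : Type} [Field F₀] [Field K] [NumberField K] [Algebra F₀ K] {v : HeightOneSpectrum (𝓞 K)}
      {Aₐ : AbelianVariety K} {𝒜ₐ : SchemeOver (valuationSubringAtPrime K v)} [GrpObj 𝒜ₐ]
      (ha : IsAbelianSchemeModel Aₐ v 𝒜ₐ) (γ : K ≃ₐ[F₀] K) (hγ : IsArithFrobAt (𝓞 F₀) γ v.asIdeal) (p n : ℕ)
      [ExpChar v.asIdeal.ResidueField p] (hq : Nat.card (𝓞 F₀ ⧸ v.asIdeal.under (𝓞 F₀)) = p ^ n)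
      (σt : AlgebraicClosure K ≃+* AlgebraicClosure K)
      (_hσa : ∀ a : K, σt (algebraMap K (AlgebraicClosure K) a) = algebraMap K (AlgebraicClosure K) (γ.toRingEquiv a))
      (_hσ𝔓 : ∀ x : absIntegers (𝓞 K) K, ∃ hx : σt x ∈ absIntegers (𝓞 K) K,
        (⟨σt x, hx⟩ : absIntegers (𝓞 K) K) - x ^ Nat.card (𝓞 F₀ ⧸ v.asIdeal.under (𝓞 F₀)) ∈ adicCompletionPrime K v)
      (y : Aₐ.geomPoints),
      (ha.goodReductionAt.conjFrob γ hγ p n hq).geomReductionMap (conjTransport γ.toRingEquiv σt _hσa Aₐ y) =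
        Hom.geomPointsMap (ha.specialFibre.relFrobenius p n) (ha.specialFibreReductionHom y)) :
    ∀ {F₀ K : Type} [Field F₀] [Field K] [NumberField K] [Algebra F₀ K] {v : HeightOneSpectrum (𝓞 K)}
      {Aᵢ Aₐ : AbelianVariety K} {𝒜ᵢ 𝒜ₐ : SchemeOver (valuationSubringAtPrime K v)} [GrpObj 𝒜ᵢ] [GrpObj 𝒜ₐ]
      (hi : IsAbelianSchemeModel Aᵢ v 𝒜ᵢ) (ha : IsAbelianSchemeModel Aₐ v 𝒜ₐ) (γ : K ≃ₐ[F₀] K)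
      (hγ : IsArithFrobAt (𝓞 F₀) γ v.asIdeal) (p n : ℕ) [ExpChar v.asIdeal.ResidueField p]
      (hq : Nat.card (𝓞 F₀ ⧸ v.asIdeal.under (𝓞 F₀)) = p ^ n)
      (σt : AlgebraicClosure K ≃+* AlgebraicClosure K)
      (hσa : ∀ a : K, σt (algebraMap K (AlgebraicClosure K) a) = algebraMap K (AlgebraicClosure K) (γ.toRingEquiv a))
      (ℓ : ℕ) [Fact ℓ.Prime] (hℓv : ((ℓ : ℕ) : 𝓞 K) ∉ v.asIdeal)
      (hσ𝔓 : ∀ x : absIntegers (𝓞 K) K, ∃ hx : σt x ∈ absIntegers (𝓞 K) K,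
        (⟨σt x, hx⟩ : absIntegers (𝓞 K) K) - x ^ Nat.card (𝓞 F₀ ⧸ v.asIdeal.under (𝓞 F₀)) ∈
          (ha.tateSpecialisation ℓ hℓv).prime)
      (Hγ : GoodReductionAt.HomReduction hi.goodReductionAt (ha.goodReductionAt.conjFrob γ hγ p n hq))
      (Hγ' : GoodReductionAt.HomReduction (ha.goodReductionAt.conjFrob γ hγ p n hq) hi.goodReductionAt),
      Hγ.IsTateCompatible (hi.tateSpecialisation ℓ hℓv)
          ((ha.tateSpecialisation ℓ hℓv).conjFrob γ hγ p n hq σt hσa hσ𝔓) ∧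
        Hγ'.IsTateCompatible ((ha.tateSpecialisation ℓ hℓv).conjFrob γ hγ p n hq σt hσa hσ𝔓)
          (hi.tateSpecialisation ℓ hℓv) := by
  intro F₀ K _ _ _ _ v Aᵢ Aₐ 𝒜ᵢ 𝒜ₐ _ _ hi ha γ hγ p n _ hq σt hσa ℓ _ hℓv hσ𝔓 Hγ Hγ'
  have hσ𝔓' : ∀ x : absIntegers (𝓞 K) K, ∃ hx : σt x ∈ absIntegers (𝓞 K) K,
      (⟨σt x, hx⟩ : absIntegers (𝓞 K) K) - x ^ Nat.card (𝓞 F₀ ⧸ v.asIdeal.under (𝓞 F₀)) ∈ adicCompletionPrime K v := by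
    intro x
    obtain ⟨hx, h⟩ := hσ𝔓 x
    exact ⟨hx, by rwa [ha.tateSpecialisation_prime ℓ hℓv] at h⟩
  have hTW' := hTW ha γ hγ p n hq σt hσa hσ𝔓'
  exact ⟨hi.isTateCompatible_conjFrob_of_twistedReductionMap ha γ hγ p n hq σt hσa ℓ hℓv hσ𝔓 Hγ hTW',
    hi.isTateCompatible_conjFrob'_of_twistedReductionMap ha γ hγ p n hq σt hσa ℓ hℓv hσ𝔓 Hγ' hTW'⟩

/-- **The tree's named Q5 (`IsAbelianSchemeModel.forall_isTateCompatible_homReduction_conjFrob_tateSpecialisation`, ★ p621613)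
from the twisted-reduction identity (TW)** stated once for all data (`σ̃` a Frobenius at `adicCompletionPrime K v`).  The named
fact is the `hQ5` text by `Iff.rfl`, so this is `forall_isTateCompatible_conjFrob_of_twistedReductionMap` re-typed.
[cite: Shimura1998, §18.6 proof of Thm. 18.6, p. 129; §11.1 Prop. 14 (i)] -/
theorem forall_isTateCompatible_homReduction_conjFrob_tateSpecialisation_of_twistedReductionMap
    (hTW : ∀ {F₀ K : Type} [Field F₀] [Field K] [NumberField K] [Algebra F₀ K] {v : HeightOneSpectrum (𝓞 K)}
      {Aₐ : AbelianVariety K} {𝒜ₐ : SchemeOver (valuationSubringAtPrime K v)} [GrpObj 𝒜ₐ]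
      (ha : IsAbelianSchemeModel Aₐ v 𝒜ₐ) (γ : K ≃ₐ[F₀] K) (hγ : IsArithFrobAt (𝓞 F₀) γ v.asIdeal) (p n : ℕ)
      [ExpChar v.asIdeal.ResidueField p] (hq : Nat.card (𝓞 F₀ ⧸ v.asIdeal.under (𝓞 F₀)) = p ^ n)
      (σt : AlgebraicClosure K ≃+* AlgebraicClosure K)
      (_hσa : ∀ a : K, σt (algebraMap K (AlgebraicClosure K) a) = algebraMap K (AlgebraicClosure K) (γ.toRingEquiv a))
      (_hσ𝔓 : ∀ x : absIntegers (𝓞 K) K, ∃ hx : σt x ∈ absIntegers (𝓞 K) K,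
        (⟨σt x, hx⟩ : absIntegers (𝓞 K) K) - x ^ Nat.card (𝓞 F₀ ⧸ v.asIdeal.under (𝓞 F₀)) ∈ adicCompletionPrime K v)
      (y : Aₐ.geomPoints),
      (ha.goodReductionAt.conjFrob γ hγ p n hq).geomReductionMap (conjTransport γ.toRingEquiv σt _hσa Aₐ y) =
        Hom.geomPointsMap (ha.specialFibre.relFrobenius p n) (ha.specialFibreReductionHom y)) :
    IsAbelianSchemeModel.forall_isTateCompatible_homReduction_conjFrob_tateSpecialisation :=
  fun hi ha γ hγ p n _ hq σt hσa ℓ _ hℓv hσ𝔓 Hγ Hγ' =>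
    forall_isTateCompatible_conjFrob_of_twistedReductionMap hTW hi ha γ hγ p n hq σt hσa ℓ hℓv hσ𝔓 Hγ Hγ'

end IsAbelianSchemeModel

end Literature.NumberTheory.DiophantineGeometry

end
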